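import Literature.MathematicalPhysics.QuantumFieldTheory.Balaban1983to89.B9Eq3105FamThreeAtLocCfgOfTails
import Literature.MathematicalPhysics.QuantumFieldTheory.Balaban1983to89.B9Eq3105FamThreeCommStepAdjAtDatum

/-!
# `Balaban1983to89.B9Eq3105FamThreeAtLocCfgOfTailsClosed` — FAMILY 3 OF (3.105): p33's RECORD PLUG `B9Eq3105FamThreeAtLocCfgOfTails` (the `hrest` summand at the
# located projection letters and `χl_□` with `hDL`, `hDR`, `hP3` supplied) WITH ITS LAST F3-E3 INPUT `hGK □` CLOSED — the member-carrier kernel of the adjoint-ordered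
# cube letter `G′_□(V′)·(Δ′_□(V′)M_{χ_□} − M_{χ_□}Δ′_□(V′))` is read off E3c's cube-side letter `hT □` at `Ṽ_□` (∃-supplied over all members by E3c
# `commStepAdj_at_datum`), a bi-contractive `u_□`, the cube (2.61) at `(δ_t, α_t)` and the rate budget `b_Kδ₀₃ ≤ (1−α_t)δ_t` (sub-row G-B9-LETTERS, GAPS G-B9-05 ∕
# G-B9-p33-01, programme FAMTHREE; lead g35 RULING FAMTHREE-6 (3): «p38's §1 … SURVIVES only as the hGK-closing corollary OF FILE 7 (importing FILE 7 by name, binder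
# list = FILE 7's minus hGK plus E3c's cube-side letters)»; seat p38 gen 48)

T. Bałaban, *Propagators for lattice gauge theories in a background field*, Commun. Math. Phys. **99** (1985) 389–434 [`Balaban1985BackgroundPropagators`, "[B9]"];
[4] = T. Bałaban, *Propagators and renormalization transformations for lattice gauge theories. II*, Commun. Math. Phys. **96** (1984) 223–250 [`Balaban1984PropagatorsII`];
[2] of [B9] = T. Bałaban, *Regularity and decay of lattice Green's functions*, Commun. Math. Phys. **89** (1983) 571–597 [`Balaban1983RegularityDecay`].

statement-level skeleton of published theorems with citation tags; proofs where landed; nothing here is a claim about the Yang–Mills mass gap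

THE PRINTED LOCUS (held `paper:balaban1985-cmp99-background-propagators`, journal page = PDF page + 388).  (3.105) p. 414 (the third sum of the expansion of
`G(U₁) − G_appr`) and p. 415 l. 26–37, in particular l. 29–31 «Next we replace the operators G′_{□₀} and C_{□₀} by G′_□, C_□, terms with the differences G′_{□₀} − G′_□
and C_{□₀} − C_□ are small by the same reason as before»; p. 412 l. 22–36 («the operators may differ outside □̃₀, and the distance from □̃ to □̃₀ᶜ is at least M»);
(3.100) p. 413; (3.88)–(3.89) p. 409 (the commutator letters); Cor. 3.6 p. 408 («U′ = U^u = e^{iηA}»); Thm 3.1 (3.42) p. 397; (3.48)–(3.49) pp. 398–399; (3.87) p. 409;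
(3.95) p. 411; [4] (2.51)–(2.55) pp. 232–233, (2.46) p. 231, Lemma 2.1 (2.60)–(2.61) p. 234, (2.83)–(2.85) pp. 237–238; [2] (1.11)–(1.12) (statement type only).

WHY THIS FILE.  p33 g104's FILE 7 `B9Eq3105FamThreeAtLocCfgOfTails.hasMajorant_sum_famThree_at_locCfg_of_tails` (p700455, sha16 5241f6c10c03c02f) is the `hrest` family-3
record `B9Eq3105FamThreeLocDiffGOfEBlock.hasMajorant_sum_famThree_at_locCfg_chiL` with `hDR □ ν` := p38 F3-E3 `B9Eq3105FamThreeLocDiffGRight.hasMajorant_hDR_at` and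
`hP3 □` := F3-B3 FILE 6 `hasMajorant_hP3_of_tails` plugged in; of F3-E3's inputs it keeps displayed the member-carrier kernel `hGK □` (`conj b(T_χ(V′)^ℝ) ≺ θ_K·e^{−b_Kδ₀₃d}`
over `(toB6 (geo9K i) Rr′ Hp, ιB∘blkOf)`, `V′ = Ṽ_□^{u⁻¹}`) and `0 ≤ θ_K`.  p38 E3b∕E3c proved that kernel: E3c `B9Eq3105FamThreeCommStepAdjAtDatum.hasMajorant_conj_commStepAdj_member_rate`
gives LITERALLY the `hGK □` shape with `θ_K := (M₂Σ‖b_j‖)²·θ_t·c₁(dB_t, δ_t, α_t)` from the cube-side letter `hT □` at `Ṽ_□` (`conj b((G′_□(Ṽ_□)(Δ′_□(Ṽ_□)M_{χ_□} −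
M_{χ_□}Δ′_□(Ṽ_□)))^ℝ) ≺ θ_t·e^{−δ_td_□}` over the cube sequence's blocks — supplied over all members above one threshold by E3c `commStepAdj_at_datum`), the bi-contractive
`u_□`, the cube (2.61) `Ineq261 dB_t (toB6 (geoCK i □) Rr H) δ_t α_t` and `b_K·δ₀₃ ≤ (1 − α_t)δ_t`.  THIS FILE is that plug and nothing else: FILE 7's theorem with the
binders `hθK`, `hGK` REPLACED by E3c's cube-side letters (`dBt`, `θt δt αt`, `hθt hδt hαt1`, `h261t`, `hT`, `hrateK`) and `θ_K` instantiated in the budget `hεR3`; same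
conclusion as FILE 7 (= the record's).

WHAT THIS FILE CERTIFIES (kernel-checked; 0 `def`, 0 `def … : Prop`, 0 sorry; standard axioms only)
* ★★★ `hasMajorant_sum_famThree_at_locCfg_of_tails_closed` — FILE 7's `hasMajorant_sum_famThree_at_locCfg_of_tails` with `hGK □` DISCHARGED by E3c
  `hasMajorant_conj_commStepAdj_member_rate` (and `0 ≤ θ_K` by positivity); displayed: everything FILE 7 displays except `hθK`∕`hGK`, plus E3c's cube-side letters.

HONEST SCOPE ∕ NOT CLAIMED.  A one-line plug of two landed theorems (FILE 7, E3c) — no new inequality of [B9].  After this file the `hrest` family-3 record displays no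
F3-E3 kernel any more; what it still displays is FILE 7's list: the letters' blocks `hE`∕`hEO`∕`hCinv`, the cube-side letters `hR □` (p21 D3's order; ∃-supplied p33 E2e)
and `hT □` (adjoint order; ∃-supplied E3c), the four units, `η = |c_f|⁻¹`, the (3.35) data, FILE 6's displayed cube words ∕ tails ∕ outer entries at `V′_□` (`hLw`, `hRop`,
`hTail0∕1∕2`, `hSbL`, `hGw`, `hPb` — p33's FILES 8a∕8b supply them), the transfers, the (2.61)'s and the budgets; the ∃-packaging over the thresholds is the assembler's.
Count-neutral; NOT a node discharge; no summit ∕ sub-problem statement is proved; nothing continuum ∕ OS ∕ mass-gap ∕ Clay; YM mass gap NOT proved (Track A conditional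
rung).  No `sorry`, no `axiom`, no `… : Prop` fact, no `instance`, no `notation`, no `def`.  NEW file; nothing landed is modified.  Cell `lit-balaban`, seat
`lit-balaban-p38` gen 48, 2026-08-29; `--supports stmt-QuantumFields-19200`.  Net new unproved facts: 0.

RELATED IN THE TREE, NOT DUPLICATED (searched 2026-08-29: `rg 'of_tails_closed|AtLocCfgOfTailsClosed' Literature/` = nothing): p33 FILE 7 `B9Eq3105FamThreeAtLocCfgOfTails`,
p38 E3c `B9Eq3105FamThreeCommStepAdjAtDatum`, p38 PT-v2 `B9Eq3105FamThreeRecordsD1Closed` (the hV′ twin, D1 closed both sides via `hasMajorant_hDR_at_of_cube`) — USED BY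
NAME ∕ parallel, not re-proved.
-/

noncomputable section

namespace Literature.MathematicalPhysics.QuantumFieldTheory.Balaban1983to89.B9Eq3105FamThreeAtLocCfgOfTailsClosed

open NormedSpace Complex
open B6RandomWalk (HasMajorant hasMajorant_mono Ineq261 c1_nonneg)
open B9Thm34Ext (toB6)
open B9FromB6 (EBlock)
open B9Ineq347 (ScaleTransfer)
open B9Eq352DivFormLetters (conj)
open B9Eq352GradLetters (diffLetter)
open B9Eq39Adjoint (fluct)
open B9Eq360DeltaPrimeAY (AfldY)
open B9Eq360DeltaPrimeACubeY (blkCubeY)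
open B6KLevelCensusIndexV1 (KIdx kGeo)
open B6Cover236MultiLevelBlocks (cubes)
open B6GlobalChartV1 (PV boxEquiv blkV1)
open B6Geom246MultiLevelBox (blkOf)
open B6Ineq2142KLevelV1 (β)
open B9GeoNormsKLevelV1 (geo9K)
open B9CubeGeometryInputs (geoCK)
open B9CubeLettersOpsL0 (deltaPrimeACubeY GpCubeY)
open B9CubeLettersBondOpsL0 (QpCubeY QpsCubeY XCubeY XinvCubeY)
open B9CubeLettersInvReadings (kernelFamilySInv kernelFamilyBInv)
open B9Thm37CubeCoverCommutators (cutMulY hTY)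
open B4PartitionUnity22 (thetaProf D1)
open B9Cor36CutoffField337 (bumpY)
open B9Cor36CubeCutoffs (SC NearC chiY ctrR locCfgY)
open B9Eq3104CutoffCommutators (hBdY DPDsY)
open B9Eq3105ZetaY (zetaY)
open B9Cor36GCubeLocLetter (locProjBY)
open B9Thm37Sum (mulOp mulOp_apply)
open B9Eq3105FamThreeAtLocCfgOfTails (hasMajorant_sum_famThree_at_locCfg_of_tails)
open B9Eq3105FamThreeCommStepAdjAtDatum (hasMajorant_conj_commStepAdj_member_rate)
open Node00 (SiteY BlkY IBondY FBondY CfgY GaugeY BondOpY BondParY toKT shiftY UboxY GpY deltaPrimeAY gaugeY parSymY parSymY_isGaugeLawS etaS QpY QpsY XY XinvY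
  gradY divY)

variable {d ℓ : ℕ} {hd : 1 ≤ d + 1} {hL : Odd (ℓ + 1) ∧ 1 < ℓ + 1} {b₀ b₁ : ℝ}
variable {𝔸 : Type} [NormedRing 𝔸] [NormedAlgebra ℂ 𝔸] [CompleteSpace 𝔸]
variable {ι : Type} [Fintype ι]
variable (i : KIdx d ℓ hd hL b₀ b₁) (b : Module.Basis ι ℝ 𝔸)

section Record

variable [Fintype (geo9K i).Site] [DecidableEq (geo9K i).Site] {Rr : ℝ} {H : Prop} {Rr' : ℝ} {Hp : Prop}
variable {B : B9.Backgrounds} (cfg : B.Cfg → CfgY 𝔸 i) (par : BondParY 𝔸 i) {U₁ : B.Cfg}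

open Classical in
set_option maxHeartbeats 12800000 in
/-- ★★★ **FAMILY 3 (`hrest` summand) AT THE LOCATED PROJECTION LETTERS WITH `hDL`, `hDR`, `hP3` SUPPLIED AND `hGK` CLOSED**: p33 FILE 7's
`hasMajorant_sum_famThree_at_locCfg_of_tails` with its displayed F3-E3 kernel `hGK □` (and `0 ≤ θ_K`) DISCHARGED by E3c `hasMajorant_conj_commStepAdj_member_rate` from
the cube-side adjoint-ordered commutator letter `hT □` at `Ṽ_□` (kernel `θ_t·e^{−δ_td_□}` over `(toB6 (geoCK i □) Rr H, blkCubeY)`), the bi-contractive `u_□`, the cube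
(2.61) at `(δ_t, α_t)` and `b_Kδ₀₃ ≤ (1−α_t)δ_t`; `θ_K := (M₂Σ‖b_j‖)²θ_tc₁(dB_t, δ_t, α_t)` in the budget `hεR3`.  Everything else displayed exactly as in FILE 7; same
conclusion (= the record's).
[cite: Balaban1985BackgroundPropagators, (3.105) p.414, p.415 l.26–37, p.412 l.22–36, (3.100) p.413, (3.88)–(3.89) p.409, Cor. 3.6 p.408, (3.42) p.397, (3.48)–(3.49) pp.398–399, (3.87) p.409, (3.95) p.411; Balaban1983RegularityDecay, (1.11)–(1.12) (statement type); Balaban1984PropagatorsII, (2.51)–(2.55) p.232, (2.46) p.231, (2.83)–(2.85) pp.237–238, Lemma 2.1 (2.60)–(2.61) p.234] -/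
theorem hasMajorant_sum_famThree_at_locCfg_of_tails_closed
    {BG δG : ℝ} (hE : EBlock (kernelFamilySInv i B cfg (fun W => GpY i (parSymY i) W) (parSymY i)) BG δG U₁) (hBG : 0 ≤ BG) (hδG0 : 0 ≤ δG)
    (Oc : ↥(cubes i.D.toDomains) → BondOpY 𝔸 i) {B₀ δ : ℝ} (hB₀ : 0 ≤ B₀) (hδ : 0 < δ)
    (hEO : ∀ c : ↥(cubes i.D.toDomains), EBlock (kernelFamilyBInv i B cfg (Oc c) par) B₀ δ U₁)
    (ιB : BlkY i → IBondY i) (hι : ∀ s, β i.hN i.D i.hk (ιB s) = s)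
    (hpar : ∀ z w : SiteY i, ‖(parSymY i (cfg U₁) z w : 𝔸)‖ ≤ 1 ∧ ‖(((parSymY i (cfg U₁) z w)⁻¹ : 𝔸ˣ) : 𝔸)‖ ≤ 1)
    {M₂ : ℝ} (hM₂ : 0 ≤ M₂) (hrepr : ∀ (v : 𝔸) (j : ι), |b.repr v j| ≤ M₂ * ‖v‖) (hη : etaS i = |i.cf|⁻¹)
    {s B₁ δX : ℝ} (hs : (etaS i ^ 2 * etaS i ^ 2) * s = 1) (hB₁ : 0 ≤ B₁)
    (hCinv : HasMajorant (g := toB6 (geo9K i) Rr' Hp) (fun q : BlkY i × ι => ιB q.1) (conj b (s • (XinvY i (parSymY i) (fun W => GpY i (parSymY i) W) (cfg U₁)).restrictScalars ℝ))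
      (fun a a' => B₁ * ((geo9K i).len a ^ 4)⁻¹ * Real.exp (-(δX * (geo9K i).dist a a'))))
    (u : ↥(cubes i.D.toDomains) → GaugeY 𝔸 i) (hu : ∀ (c : ↥(cubes i.D.toDomains)) (x), ‖((u c x : 𝔸ˣ) : 𝔸)‖ ≤ 1 ∧ ‖(((u c x)⁻¹ : 𝔸ˣ) : 𝔸)‖ ≤ 1)
    (A : ↥(cubes i.D.toDomains) → AfldY 𝔸 i)
    (Q : ↥(cubes i.D.toDomains) → Set (Site (PV d ℓ i.m i.K hd hL) 0)) (η : ℝ)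
    (hQ : ∀ (c : ↥(cubes i.D.toDomains)) (x : Site (PV d ℓ i.m i.K hd hL) 0), NearC i c (35 * SC i c / 8 + 1) (boxEquiv i.hN x).1 → x ∈ Q c)
    (hgA : ∀ (c : ↥(cubes i.D.toDomains)) (κ : Fin (d + 1)) (x : Site (PV d ℓ i.m i.K hd hL) 0), x ∈ Q c → x.shift κ ∈ Q c →
      gaugeY i (u c) (cfg U₁) κ x = fluct η (A c) κ x)
    (hU : IsUnit (deltaPrimeAY i (parSymY i) (cfg U₁)))
    (hV : ∀ c : ↥(cubes i.D.toDomains), IsUnit (deltaPrimeACubeY i c (parSymY i) (gaugeY i (u c)⁻¹ (locCfgY i c η (A c)))))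
    (dBc dBE : ℕ) {θ δc αc asep ρE bb : ℝ} (hθ : 0 ≤ θ) (hδc : 0 ≤ δc) (hαc1 : αc ≤ 1) (hasep : 0 ≤ asep) (hρE : 0 ≤ ρE) (hsplitE : asep + ρE ≤ 1)
    (hrate : bb * δG ≤ (1 - αc) * δc) (h261c : ∀ c : ↥(cubes i.D.toDomains), Ineq261 dBc (toB6 (geoCK i c) Rr H) δc αc)
    (h261E : Ineq261 dBE (toB6 (geo9K i) Rr' Hp) δG (bb - ρE))
    (hR : ∀ c : ↥(cubes i.D.toDomains), HasMajorant (g := toB6 (geoCK i c) Rr H) (fun p : SiteY i × ι => blkCubeY i c p.1)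
      (conj b (((cutMulY (𝔸 := 𝔸) (chiY i c) * deltaPrimeACubeY i c (parSymY i) (locCfgY i c η (A c)) -
          deltaPrimeACubeY i c (parSymY i) (locCfgY i c η (A c)) * cutMulY (𝔸 := 𝔸) (chiY i c)) * GpCubeY i c (parSymY i) (locCfgY i c η (A c))).restrictScalars ℝ))
      (fun a s' => θ * Real.exp (-(δc * (geoCK i c).dist a s'))))
    {εT δT εR δR : ℝ}
    (hεDT : (M₂ * (∑ j, ‖b j‖) * BG * (1 + D1 thetaProf / 3)) *
          (Real.exp (-(asep * δG * (3 / 8 * (i.Mh : ℝ) - 1))) +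
            ((M₂ * ∑ j, ‖b j‖) ^ 2 * (θ * B6.c1 dBc δc αc)) * B6.c1 dBE δG (bb - ρE) * Real.exp (-(asep * δG * (3 / 8 * (i.Mh : ℝ) - 2)))) ≤ εT)
    (hδDT : δT ≤ ρE * δG) (hεR : εR ≤ εT) (hδR : δT ≤ δR)
    -- F3-E3 (p38 `hasMajorant_hDR_at`) with `hGK` CLOSED by E3c: E3's transfers and budgets, then E3c's cube-side letters in place of `hGK`
    (dB3 : ℕ) {δ₀3 aG α3 Λ3 bK αst3 Λst asep3 ρ3 : ℝ} (hδ₀3 : 0 ≤ δ₀3) (haG : aG * δ₀3 ≤ δG) (hα3 : 0 ≤ α3) (hΛ3 : 0 ≤ Λ3)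
    (hT13 : ScaleTransfer (geo9K i) δ₀3 α3 Λ3 (fun a => (geo9K i).len a)) (hΛst : 0 ≤ Λst)
    (hTst : ScaleTransfer (geo9K i) δ₀3 αst3 Λst (fun a => (geo9K i).len a)) (hasep3 : 0 ≤ asep3) (hρ3 : 0 ≤ ρ3) (hsplitL : αst3 + ρ3 ≤ bK)
    (hsplit3 : α3 + asep3 + ρ3 ≤ aG) (h2613 : Ineq261 dB3 (toB6 (geo9K i) Rr' Hp) δ₀3 (aG - α3 - asep3 - ρ3))
    (dBt : ℕ) {θt δt αt : ℝ} (hθt : 0 ≤ θt) (hδt : 0 ≤ δt) (hαt1 : αt ≤ 1)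
    (h261t : ∀ c : ↥(cubes i.D.toDomains), Ineq261 dBt (toB6 (geoCK i c) Rr H) δt αt)
    (hT : ∀ c : ↥(cubes i.D.toDomains), HasMajorant (g := toB6 (geoCK i c) Rr H) (fun p : SiteY i × ι => blkCubeY i c p.1)
      (conj b ((GpCubeY i c (parSymY i) (locCfgY i c η (A c)) *
          (deltaPrimeACubeY i c (parSymY i) (locCfgY i c η (A c)) * cutMulY (𝔸 := 𝔸) (chiY i c) -
            cutMulY (𝔸 := 𝔸) (chiY i c) * deltaPrimeACubeY i c (parSymY i) (locCfgY i c η (A c)))).restrictScalars ℝ))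
      (fun a s' => θt * Real.exp (-(δt * (geoCK i c).dist a s'))))
    (hrateK : bK * δ₀3 ≤ (1 - αt) * δt)
    (hεR3 : (M₂ * (∑ j, ‖b j‖) * BG * (1 + Λ3 * (D1 thetaProf / 3)) *
        (Real.exp (-(asep3 * δ₀3 * (3 / 8 * (i.Mh : ℝ) - 1))) + ((M₂ * ∑ j, ‖b j‖) ^ 2 * (θt * B6.c1 dBt δt αt)) * Λst * B6.c1 dB3 δ₀3 (aG - α3 - asep3 - ρ3) * Real.exp (-(asep3 * δ₀3 * (3 / 8 * (i.Mh : ℝ) - 3))))) ≤ εR)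
    (hδR' : δR ≤ ρ3 * δ₀3)
    -- F3-B3 (this lane, FILE 6 `hasMajorant_hP3_of_tails`): the four units, budgets, and the displayed cube tails ∕ outer entries at `V′_□`
    (hX : IsUnit (XY i (parSymY i) (fun W => GpY i (parSymY i) W) (cfg U₁)))
    (hXc : ∀ c : ↥(cubes i.D.toDomains), IsUnit (XCubeY i c (parSymY i) (gaugeY i (u c)⁻¹ (locCfgY i c η (A c)))))
    (dBw : ℕ) {κL κPb κT0 κT1 κT2 κSb κR κG r₀ rT0 rT1 rT2 rSb rR rG δ₀w αw βw asepw CS CA CT3 CT1 C1 : ℝ}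
    (hκL : 0 ≤ κL) (hκPb : 0 ≤ κPb) (hκT0 : 0 ≤ κT0) (hκT1 : 0 ≤ κT1) (hκT2 : 0 ≤ κT2) (hκSb : 0 ≤ κSb) (hκR : 0 ≤ κR) (hκG : 0 ≤ κG)
    (hCS : 0 ≤ CS) (hCA : 0 ≤ CA) (hCT3 : 0 ≤ CT3) (hCT1 : 0 ≤ CT1) (hC1 : 0 ≤ C1)
    (hαδw : 0 ≤ αw * δ₀w) (hε0w : 0 ≤ (αw + βw) * δ₀w) (hasepw : 0 ≤ asepw) (hρw0 : 0 ≤ r₀ - 5 * ((αw + βw) * δ₀w) - asepw)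
    (hrSw : r₀ - (αw + βw) * δ₀w ≤ δX) (hrAw : r₀ - 2 * ((αw + βw) * δ₀w) ≤ δG) (hrcw : r₀ - 3 * ((αw + βw) * δ₀w) - asepw ≤ bb * δG)
    (hrT0 : r₀ - 4 * ((αw + βw) * δ₀w) - asepw ≤ rT0) (hrT1 : r₀ - 4 * ((αw + βw) * δ₀w) - asepw ≤ rT1) (hrT2 : r₀ - 2 * ((αw + βw) * δ₀w) - asepw ≤ rT2)
    (hrSb : r₀ - (αw + βw) * δ₀w ≤ rSb) (hrR : r₀ - 2 * ((αw + βw) * δ₀w) - asepw ≤ rR) (hrG : r₀ - 5 * ((αw + βw) * δ₀w) - asepw ≤ rG)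
    (hST4w : ScaleTransfer (geo9K i) δ₀w αw CS (fun a => ((geo9K i).len a ^ 4)⁻¹)) (hST2w : ScaleTransfer (geo9K i) δ₀w αw CA (fun a => (geo9K i).len a ^ 2))
    (hST3w : ScaleTransfer (geo9K i) δ₀w αw CT3 (fun a => ((geo9K i).len a ^ 3)⁻¹)) (hSTm1w : ScaleTransfer (geo9K i) δ₀w αw CT1 (fun a => ((geo9K i).len a)⁻¹))
    (hST1w : ScaleTransfer (geo9K i) δ₀w αw C1 (fun a => (geo9K i).len a)) (h261w : Ineq261 dBw (toB6 (geo9K i) Rr' Hp) δ₀w βw)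
    (hLw : ∀ (c : ↥(cubes i.D.toDomains)) (μ : Fin (d + 1)), HasMajorant (g := toB6 (geo9K i) Rr' Hp) (fun p : SiteY i × ι => ιB (blkOf i.D.toDomains p.1))
      (conj b (diffLetter (shiftY i) (UboxY i (cfg U₁)) (((etaS i : ℝ) : ℂ))⁻¹ (Sum.inl μ)) * mulOp (fun p : SiteY i × ι => bumpY i (ctrR i c) (3 * (SC i c : ℝ)) p.1) *
        conj b (((((etaS i ^ 2 : ℝ) : ℂ)) • GpCubeY i c (parSymY i) (gaugeY i (u c)⁻¹ (locCfgY i c η (A c)))).restrictScalars ℝ))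
      (fun a a' : (geo9K i).Site => (if a ∈ (Finset.univ.filter fun a : (geo9K i).Site => ∃ z : SiteY i, ιB (blkOf i.D.toDomains z) = a ∧ NearC i c (21 * SC i c / 8 + 1) z.1)
        then (1 : ℝ) else 0) * (κL * (geo9K i).len a * Real.exp (-(r₀ * (geo9K i).dist a a')))))
    (hRop : ∀ (c : ↥(cubes i.D.toDomains)) (ν : Fin (d + 1)), HasMajorant (g := toB6 (geo9K i) Rr' Hp) (fun p : SiteY i × ι => ιB (blkOf i.D.toDomains p.1))
      (conj b (((((etaS i ^ 2 : ℝ) : ℂ)) • GpCubeY i c (parSymY i) (gaugeY i (u c)⁻¹ (locCfgY i c η (A c)))).restrictScalars ℝ) *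
        mulOp (fun p : SiteY i × ι => bumpY i (ctrR i c) (3 * (SC i c : ℝ)) p.1) * conj b (diffLetter (shiftY i) (UboxY i (cfg U₁)) (((etaS i : ℝ) : ℂ))⁻¹ (Sum.inr ν)))
      (fun a a' => κR * (geo9K i).len a * Real.exp (-(rR * (geo9K i).dist a a'))))
    (hTail0 : ∀ (c : ↥(cubes i.D.toDomains)) (ν : Fin (d + 1)), HasMajorant (g := toB6 (geo9K i) Rr' Hp) (fun p : SiteY i × ι => ιB (blkOf i.D.toDomains p.1))
      (conj b ((((s : ℝ) : ℂ) • (QpsCubeY i c (parSymY i) (gaugeY i (u c)⁻¹ (locCfgY i c η (A c))) ∘ₗ XinvCubeY i c (parSymY i) (gaugeY i (u c)⁻¹ (locCfgY i c η (A c))) ∘ₗ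
            QpCubeY i c (parSymY i) (gaugeY i (u c)⁻¹ (locCfgY i c η (A c))))).restrictScalars ℝ) *
        mulOp (fun p : SiteY i × ι => if NearC i c (3 * SC i c) p.1.1 then (1 : ℝ) else 0) *
        (conj b (((((etaS i ^ 2 : ℝ) : ℂ)) • GpCubeY i c (parSymY i) (gaugeY i (u c)⁻¹ (locCfgY i c η (A c)))).restrictScalars ℝ) *
          mulOp (fun p : SiteY i × ι => bumpY i (ctrR i c) (3 * (SC i c : ℝ)) p.1) * conj b (diffLetter (shiftY i) (UboxY i (cfg U₁)) (((etaS i : ℝ) : ℂ))⁻¹ (Sum.inr ν))))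
      (fun a a' => κT0 * ((geo9K i).len a ^ 3)⁻¹ * Real.exp (-(rT0 * (geo9K i).dist a a'))))
    (hTail1 : ∀ (c : ↥(cubes i.D.toDomains)) (ν : Fin (d + 1)), HasMajorant (g := toB6 (geo9K i) Rr' Hp) (fun p : SiteY i × ι => ιB (blkOf i.D.toDomains p.1))
      (conj b (((((etaS i ^ 2 : ℝ) : ℂ)) • GpCubeY i c (parSymY i) (gaugeY i (u c)⁻¹ (locCfgY i c η (A c)))).restrictScalars ℝ) *
        (conj b ((((s : ℝ) : ℂ) • (QpsCubeY i c (parSymY i) (gaugeY i (u c)⁻¹ (locCfgY i c η (A c))) ∘ₗ XinvCubeY i c (parSymY i) (gaugeY i (u c)⁻¹ (locCfgY i c η (A c))) ∘ₗ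
            QpCubeY i c (parSymY i) (gaugeY i (u c)⁻¹ (locCfgY i c η (A c))))).restrictScalars ℝ) *
          mulOp (fun p : SiteY i × ι => if NearC i c (3 * SC i c) p.1.1 then (1 : ℝ) else 0) *
          (conj b (((((etaS i ^ 2 : ℝ) : ℂ)) • GpCubeY i c (parSymY i) (gaugeY i (u c)⁻¹ (locCfgY i c η (A c)))).restrictScalars ℝ) *
          mulOp (fun p : SiteY i × ι => bumpY i (ctrR i c) (3 * (SC i c : ℝ)) p.1) * conj b (diffLetter (shiftY i) (UboxY i (cfg U₁)) (((etaS i : ℝ) : ℂ))⁻¹ (Sum.inr ν)))))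
      (fun a a' => κT1 * ((geo9K i).len a)⁻¹ * Real.exp (-(rT1 * (geo9K i).dist a a'))))
    (hTail2 : ∀ (c : ↥(cubes i.D.toDomains)) (ν : Fin (d + 1)), HasMajorant (g := toB6 (geo9K i) Rr' Hp) (fun p : SiteY i × ι => ιB (blkOf i.D.toDomains p.1))
      (conj b (((((etaS i ^ 2 : ℝ) : ℂ)) • GpCubeY i c (parSymY i) (gaugeY i (u c)⁻¹ (locCfgY i c η (A c)))).restrictScalars ℝ) *
        conj b (((((etaS i ^ 2 : ℝ) : ℂ)) • GpCubeY i c (parSymY i) (gaugeY i (u c)⁻¹ (locCfgY i c η (A c)))).restrictScalars ℝ) *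
        (conj b ((((s : ℝ) : ℂ) • (QpsCubeY i c (parSymY i) (gaugeY i (u c)⁻¹ (locCfgY i c η (A c))) ∘ₗ XinvCubeY i c (parSymY i) (gaugeY i (u c)⁻¹ (locCfgY i c η (A c))) ∘ₗ
            QpCubeY i c (parSymY i) (gaugeY i (u c)⁻¹ (locCfgY i c η (A c))))).restrictScalars ℝ) *
          mulOp (fun p : SiteY i × ι => if NearC i c (3 * SC i c) p.1.1 then (1 : ℝ) else 0) *
          (conj b (((((etaS i ^ 2 : ℝ) : ℂ)) • GpCubeY i c (parSymY i) (gaugeY i (u c)⁻¹ (locCfgY i c η (A c)))).restrictScalars ℝ) *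
          mulOp (fun p : SiteY i × ι => bumpY i (ctrR i c) (3 * (SC i c : ℝ)) p.1) * conj b (diffLetter (shiftY i) (UboxY i (cfg U₁)) (((etaS i : ℝ) : ℂ))⁻¹ (Sum.inr ν)))))
      (fun a a' => κT2 * (geo9K i).len a * Real.exp (-(rT2 * (geo9K i).dist a a'))))
    (hSbL : ∀ c : ↥(cubes i.D.toDomains), HasMajorant (g := toB6 (geo9K i) Rr' Hp) (fun p : SiteY i × ι => ιB (blkOf i.D.toDomains p.1))
      (mulOp (fun p : SiteY i × ι => if NearC i c (3 * SC i c) p.1.1 then (1 : ℝ) else 0) *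
        conj b ((((s : ℝ) : ℂ) • (QpsCubeY i c (parSymY i) (gaugeY i (u c)⁻¹ (locCfgY i c η (A c))) ∘ₗ XinvCubeY i c (parSymY i) (gaugeY i (u c)⁻¹ (locCfgY i c η (A c))) ∘ₗ
            QpCubeY i c (parSymY i) (gaugeY i (u c)⁻¹ (locCfgY i c η (A c))))).restrictScalars ℝ))
      (fun a a' => κSb * ((geo9K i).len a ^ 4)⁻¹ * Real.exp (-(rSb * (geo9K i).dist a a'))))
    (hGw : ∀ (c : ↥(cubes i.D.toDomains)) (ν : Fin (d + 1)), HasMajorant (g := toB6 (geo9K i) Rr' Hp) (fun p : SiteY i × ι => ιB (blkOf i.D.toDomains p.1))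
      (conj b ((((s : ℝ) : ℂ) • (QpsCubeY i c (parSymY i) (gaugeY i (u c)⁻¹ (locCfgY i c η (A c))) ∘ₗ XinvCubeY i c (parSymY i) (gaugeY i (u c)⁻¹ (locCfgY i c η (A c))) ∘ₗ
            QpCubeY i c (parSymY i) (gaugeY i (u c)⁻¹ (locCfgY i c η (A c))))).restrictScalars ℝ) *
        (conj b (((((etaS i ^ 2 : ℝ) : ℂ)) • GpCubeY i c (parSymY i) (gaugeY i (u c)⁻¹ (locCfgY i c η (A c)))).restrictScalars ℝ) *
          mulOp (fun p : SiteY i × ι => bumpY i (ctrR i c) (3 * (SC i c : ℝ)) p.1) * conj b (diffLetter (shiftY i) (UboxY i (cfg U₁)) (((etaS i : ℝ) : ℂ))⁻¹ (Sum.inr ν))))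
      (fun a a' => κG * ((geo9K i).len a ^ 3)⁻¹ * Real.exp (-(rG * (geo9K i).dist a a'))))
    (hPb : ∀ c : ↥(cubes i.D.toDomains), HasMajorant (g := toB6 (geo9K i) Rr' Hp) (fun p : SiteY i × ι => ιB (blkOf i.D.toDomains p.1))
      (conj b ((QpsCubeY i c (parSymY i) (gaugeY i (u c)⁻¹ (locCfgY i c η (A c))) ∘ₗ QpCubeY i c (parSymY i) (gaugeY i (u c)⁻¹ (locCfgY i c η (A c)))).restrictScalars ℝ))
      (fun a a' : (geo9K i).Site => if a = a' then κPb else 0))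
    (dB : ℕ) {δ₀ δP α β' ρ Λ : ℝ} (hΛ : 1 ≤ Λ) (hρ : 0 ≤ ρ) (hα : 0 ≤ α) (hβ : 0 ≤ β') (hδ₀ : 0 ≤ δ₀)
    (hδG' : δP ≤ δG) (hδX' : δP ≤ δX) (hδD' : δP ≤ δT) (hr : ρ + (2 * α + β') * δ₀ ≤ δP)
    (h261 : Ineq261 dB (toB6 (geo9K i) Rr' Hp) δ₀ β')
    (hT1 : ScaleTransfer (geo9K i) δ₀ α Λ (fun a => (geo9K i).len a)) (hT4 : ScaleTransfer (geo9K i) δ₀ α Λ (fun a => ((geo9K i).len a ^ 4)⁻¹))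
    {ε₃ : ℝ}
    (hε₃w : ((d : ℝ) + 1) *
          (κL * ((M₂ * ∑ j, ‖b j‖) ^ 2 * B₁) * κPb * κT2 * (CS * C1) * B6.c1 dBw δ₀w βw ^ 2 * Real.exp (-(asepw * (3 / 8 * (i.Mh : ℝ) - 1))) +
            κL * ((M₂ * ∑ j, ‖b j‖) ^ 2 * B₁) * (M₂ * (∑ j, ‖b j‖) * BG) ^ 2 * (M₂ * ∑ j, ‖b j‖) ^ 2 * κT0 * (CS * CA ^ 2 * CT3) * B6.c1 dBw δ₀w βw ^ 4 *
              Real.exp (-(asepw * (3 / 8 * (i.Mh : ℝ) - 1))) +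
            κL * ((M₂ * ∑ j, ‖b j‖) ^ 2 * B₁) * (M₂ * (∑ j, ‖b j‖) * BG) ^ 2 * ((M₂ * ∑ j, ‖b j‖) ^ 2 * (θ * B6.c1 dBc δc αc)) * κT0 * (CS * CA ^ 2 * CT3) *
              B6.c1 dBw δ₀w βw ^ 5 * Real.exp (-(asepw * (3 / 8 * (i.Mh : ℝ) - 2))) +
            κL * ((M₂ * ∑ j, ‖b j‖) ^ 2 * B₁) * (M₂ * (∑ j, ‖b j‖) * BG) * ((M₂ * ∑ j, ‖b j‖) ^ 2 * (θ * B6.c1 dBc δc αc)) * κT1 * (CS * CA * CT1) *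
              B6.c1 dBw δ₀w βw ^ 4 * Real.exp (-(asepw * (3 / 8 * (i.Mh : ℝ) - 2))) +
            κL * ((M₂ * ∑ j, ‖b j‖) ^ 2 * B₁) * κR * (CS * C1) * B6.c1 dBw δ₀w βw ^ 2 * Real.exp (-(asepw * (3 / 8 * (i.Mh : ℝ) - 1))) +
            κL * κSb * κR * (CS * C1) * B6.c1 dBw δ₀w βw ^ 2 * Real.exp (-(asepw * (3 / 8 * (i.Mh : ℝ) - 1))) +
            κL * Real.exp (-(asepw * (3 / 8 * (i.Mh : ℝ) - 1))) * (((M₂ * ∑ j, ‖b j‖) ^ 2 * B₁) * κR * C1 * B6.c1 dBw δ₀w βw) * CT3 * B6.c1 dBw δ₀w βw +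
            κL * Real.exp (-(asepw * (3 / 8 * (i.Mh : ℝ) - 1))) * κG * CT3 * B6.c1 dBw δ₀w βw) ≤ ε₃)
    (hρw : ρ ≤ r₀ - 5 * ((αw + βw) * δ₀w) - asepw)
    (dB' : ℕ) {αst ρ' Λ' : ℝ} (hΛ' : 0 ≤ Λ') (hρ' : 0 ≤ ρ') (hsplit : αst + ρ' ≤ ρ / δ)
    (h261' : Ineq261 dB' (toB6 (geo9K i) Rr' Hp) δ (1 - ρ')) (hST : ScaleTransfer (geo9K i) δ αst Λ' (fun a => (geo9K i).len a ^ 2)) :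
    HasMajorant (g := toB6 (geo9K i) Rr' Hp) (fun p : FBondY i × ι => ιB (blkV1 i.hN i.D p.1))
      (∑ c : ↥(cubes i.D.toDomains), conj b ((cutMulY (𝔸 := 𝔸) (hBdY i (zetaY i c)) *
        (DPDsY i (parSymY i) (fun W => GpY i (parSymY i) W) (cfg U₁) - locProjBY i c (parSymY i) (u c) (locCfgY i c η (A c))) *
        (cutMulY (𝔸 := 𝔸) (hBdY i (hTY i c)) * Oc c (cfg U₁) * cutMulY (𝔸 := 𝔸) (hBdY i (hTY i c)))).restrictScalars ℝ))
      (fun a b' => (3 * 5 ^ (d + 1)) *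
        ((((M₂ * ∑ j, ‖b j‖) * (M₂ * ∑ j, ‖b j‖) * B₁ * Λ ^ 4 * B6.c1 dB δ₀ β' ^ 2 *
              (((d : ℝ) + 1) * εT * (2 * (M₂ * (∑ j, ‖b j‖) * BG) + εT)) + ε₃) *
            (M₂ * (∑ j, ‖b j‖) * B₀) * Λ' * B6.c1 dB' δ (1 - ρ')) * Real.exp (-(ρ' * δ * (geo9K i).dist a b')))) := by
  have hSum : 0 ≤ M₂ * ∑ j, ‖b j‖ := mul_nonneg hM₂ (Finset.sum_nonneg fun j _ => norm_nonneg _)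
  have hc1 : 0 ≤ B6.c1 dBt δt αt := c1_nonneg _ _ _
  exact hasMajorant_sum_famThree_at_locCfg_of_tails i b cfg par hE hBG hδG0 Oc hB₀ hδ hEO ιB hι hpar hM₂ hrepr hη hs hB₁ hCinv u hu A Q η hQ hgA hU hV dBc dBE hθ hδc hαc1 hasep hρE hsplitE hrate h261c h261E hR hεDT hδDT hεR hδR dB3 hδ₀3 haG hα3 hΛ3 hT13 (by positivity) hΛst hTst hasep3 hρ3 hsplitL hsplit3 h2613 (fun c => hasMajorant_conj_commStepAdj_member_rate i c b hM₂ hrepr (parSymY_isGaugeLawS i) (u c) (hu c) (locCfgY i c η (A c)) ιB hι dBt hθt hδt hαt1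
      hrateK (h261t c) (hT c)) hεR3 hδR' hX hXc dBw hκL hκPb hκT0 hκT1 hκT2 hκSb hκR hκG hCS hCA hCT3 hCT1 hC1 hαδw hε0w hasepw hρw0 hrSw hrAw hrcw hrT0 hrT1 hrT2 hrSb hrR hrG hST4w hST2w hST3w hSTm1w hST1w h261w hLw hRop hTail0 hTail1 hTail2 hSbL hGw hPb dB hΛ hρ hα hβ hδ₀ hδG' hδX' hδD' hr h261 hT1 hT4 hε₃w hρw dB' hΛ' hρ' hsplit h261' hST

end Record

end Literature.MathematicalPhysics.QuantumFieldTheory.Balaban1983to89.B9Eq3105FamThreeAtLocCfgOfTailsClosed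

end
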